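import Summits.ValiantsHypothesis.ValiantsHypothesis.Theorems.LacunarySymmetroidMatrixDescartesCensusCUSound

/-!
# `MatrixDescartes` census — chamber-uniform checker, second layer: PIECES as `argmax` splits and SIGNED rank rows (definitions + soundness)

HONEST FRAMING.  Object-search cell `pub-symmetroid`; door-A item `DoorA26 = PosRootLawAt 2 6 19`
(stmt-ValiantsHypothesis-19979; OPEN, typed, never asserted).  A thin second certificate layer `CU.Cert2` on top of the landed
chamber-uniform checker (`…CensusCUCheck`, soundness `…CensusCUSound*`): besides `CU.Cert` leaves and binary exponent splits it has the
`k`-way ARGMAX split (`k = 3, 4, 5`) on linear forms `f_0 … f_{k−1}` in the exponents — child `v` is checked in the context extended by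
`f_v − f_u ≥ 0` (`u ≠ v`) — which is exactly the shape of the kit's VERTEX-ORDERED PIECE covers of a simplicial chamber cone (barycentric
coordinates `λ_v`, pieces «`λ_{v₁} ≥ λ_{v₂} ≥ … ≥` the rest», generator gen7p: 50–110 files per chamber) — here one table row per chamber.
Also `CU.Cert2.domM4`: domination of the SIGNED rank row `±M4(r|c) ≥ 0` read as an inequality (only opposite-sign terms need competitors —
the shape of engine val-sym-eng-1's T5 certificates).  Soundness `CU.certOK2_sound` (some `v` attains the maximum; a rank row is `= 0`), main theorems `CU.posRootLawOn_of_checkChamber2`,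
`CU.doorA26_on_chambers_of_checkTable2`.  Nothing here bears on `V = 19`, on `DoorA26` itself (OPEN), on `MatrixDescartes`
(stmt-ValiantsHypothesis-18050) or on `VP ≠ VNP`.

[folklore] Certificate-checker definitions and soundness; elementary.
-/

-- the D-0017 layout repeats a namespace component (single-conjunct summit); the `dupNamespace` linter flags it; name mandated.
set_option linter.dupNamespace false

namespace Summit.ValiantsHypothesis.ValiantsHypothesis.Theorems.LacunarySymmetroidMatrixDescartes.Census.CU

open V20 (Atom aval Epos pdet)

/-! ## Certificates with argmax splits -/

/-- Second-layer certificates: a `CU.Cert` leaf, a binary exponent split, or an argmax split over 3, 4 or 5 linear forms. [folklore] -/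
inductive Cert2 where
  /-- a first-layer certificate -/
  | leaf (c : Cert)
  /-- case split on the sign of `h` -/
  | splitD (h : LinD) (pos neg : Cert2)
  /-- `f_v` is the largest of three forms: child `v` -/
  | argmax3 (f0 f1 f2 : LinD) (c0 c1 c2 : Cert2)
  /-- `f_v` is the largest of four forms: child `v` -/
  | argmax4 (f0 f1 f2 f3 : LinD) (c0 c1 c2 c3 : Cert2)
  /-- `f_v` is the largest of five forms: child `v` -/
  | argmax5 (f0 f1 f2 f3 f4 : LinD) (c0 c1 c2 c3 c4 : Cert2)
  /-- domination of the SIGNED rank row `±M4(r | c) ≥ 0` read as an inequality: only the terms of sign opposite to the dominating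
  term `n0` need competitors (the same-sign terms help) -/
  | domM4 (r c : List ℕ) (neg : Bool) (n0 : ℕ) (ud : ℕ) (comps : List Comp)

/-- Negate every coefficient. [folklore] -/
def negTerms (P : List V20.Term) : List V20.Term := P.map fun T => (-T.1, T.2)

/-- The signed rank row `±M4(r | c)` as a term list. [folklore] -/
def signedM4 (r c : List ℕ) (neg : Bool) : List V20.Term := if neg then negTerms (m4Poly r c) else m4Poly r c

/-- Domination check for a term list KNOWN to be `≥ 0` under the model (here: a signed rank row, which is `= 0`): the dominating term `n0`
is negative under the pattern, every positive term has a competitor bound, `Σ u_k < 1` (verbatim the inequality branch of `CU.domOK`). [folklore] -/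
def domPolyOK (ctx : List LinD) (ctxL : List LRow) (ord : List Atom) (s : Bool) (poly : List V20.Term) (n0 ud : ℕ)
    (comps : List Comp) : Bool :=
  let need := V20.posTerms ord s poly
  decide (n0 < poly.length) && V20.termNeg ord s (poly.getD n0 (0, [])) &&
    decide (0 < ud) && decide (∀ T ∈ poly, T.1 ≠ 0) && decide (∀ T ∈ poly, ∀ a ∈ T.2, a ∈ V20.allAtoms) &&
    decide (∀ k ∈ need, ∃ c ∈ comps, c.k = k) && decide (∀ c ∈ comps, c.k ∈ need) &&
    decide ((comps.map Comp.k).Nodup) && decide ((comps.map Comp.un).sum < ud) &&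
    comps.all (compOK ctx ctxL ord s poly n0 ud)

/-- The context of child `v`: the differences `f_v − f_u`, `u ≠ v`. [folklore] -/
def maxCtx (fv : LinD) (others : List LinD) : List LinD := others.map fun g => ldSub fv g

/-- Check a second-layer certificate against the two contexts. [folklore] -/
def certOK2 (ord : List Atom) (s : Bool) : List LinD → List LRow → Cert2 → Bool
  | ctx, ctxL, .leaf c => certOK ord s ctx ctxL c
  | ctx, ctxL, .splitD h cp cn => certOK2 ord s (ctx ++ [h]) ctxL cp && certOK2 ord s (ctx ++ [ldSmul (-1) h]) ctxL cn
  | ctx, ctxL, .argmax3 f0 f1 f2 c0 c1 c2 =>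
    certOK2 ord s (ctx ++ maxCtx f0 [f1, f2]) ctxL c0 && certOK2 ord s (ctx ++ maxCtx f1 [f0, f2]) ctxL c1 &&
      certOK2 ord s (ctx ++ maxCtx f2 [f0, f1]) ctxL c2
  | ctx, ctxL, .argmax4 f0 f1 f2 f3 c0 c1 c2 c3 =>
    certOK2 ord s (ctx ++ maxCtx f0 [f1, f2, f3]) ctxL c0 && certOK2 ord s (ctx ++ maxCtx f1 [f0, f2, f3]) ctxL c1 &&
      certOK2 ord s (ctx ++ maxCtx f2 [f0, f1, f3]) ctxL c2 && certOK2 ord s (ctx ++ maxCtx f3 [f0, f1, f2]) ctxL c3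
  | ctx, ctxL, .argmax5 f0 f1 f2 f3 f4 c0 c1 c2 c3 c4 =>
    certOK2 ord s (ctx ++ maxCtx f0 [f1, f2, f3, f4]) ctxL c0 && certOK2 ord s (ctx ++ maxCtx f1 [f0, f2, f3, f4]) ctxL c1 &&
      certOK2 ord s (ctx ++ maxCtx f2 [f0, f1, f3, f4]) ctxL c2 && certOK2 ord s (ctx ++ maxCtx f3 [f0, f1, f2, f4]) ctxL c3 &&
      certOK2 ord s (ctx ++ maxCtx f4 [f0, f1, f2, f3]) ctxL c4
  | ctx, ctxL, .domM4 r c neg n0 ud comps =>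
    (PSpec.m4 r c).valid && domPolyOK ctx ctxL ord s (signedM4 r c neg) n0 ud comps

/-- **Check a chamber** with second-layer certificates for both orientations. [folklore] -/
def checkChamber2 (ord : List Atom) (cpos cneg : Cert2) : Bool :=
  ordAtomsOK ord && certOK2 ord true (baseCtx ord) [] cpos && certOK2 ord false (baseCtx ord) [] cneg

/-! ## Soundness -/

variable {ord : List Atom} {s : Bool} {x : ℕ → ℝ} {v : Atom → ℝ} (d : Fin 6 → ℕ)

/-- The extended context of the maximising child is non-negative. [folklore] -/
theorem maxCtx_nonneg {ctx : List LinD} (hctx : ∀ G ∈ ctx, 0 ≤ G.ev d) {fv : LinD} {others : List LinD}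
    (hmax : ∀ g ∈ others, g.ev d ≤ fv.ev d) : ∀ G ∈ ctx ++ maxCtx fv others, 0 ≤ G.ev d := by
  intro G hG
  rcases List.mem_append.1 hG with hG | hG
  · exact hctx G hG
  · unfold maxCtx at hG
    rw [List.mem_map] at hG
    obtain ⟨g, hg, rfl⟩ := hG
    rw [ev_ldSub]
    linarith [hmax g hg]

/-- Among finitely many reals one is the largest (list form used by the argmax splits). [folklore] -/
theorem exists_max_of_list (L : List LinD) (hL : L ≠ []) : ∃ f ∈ L, ∀ g ∈ L, g.ev d ≤ f.ev d := by
  classical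
  have hne : L.toFinset.Nonempty := by
    obtain ⟨a, ha⟩ := List.exists_mem_of_ne_nil L hL
    exact ⟨a, List.mem_toFinset.2 ha⟩
  obtain ⟨f, hf, hmax⟩ := Finset.exists_max_image L.toFinset (fun F : LinD => F.ev d) hne
  exact ⟨f, List.mem_toFinset.1 hf, fun g hg => hmax g (List.mem_toFinset.2 hg)⟩

/-- Negating coefficients negates the value. [folklore] -/
theorem pval_negTerms (w : Atom → ℝ) : ∀ P : List V20.Term, V20.pval w (negTerms P) = -V20.pval w P
  | [] => by simp [negTerms, V20.pval]
  | T :: P => by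
    have ih := pval_negTerms w P
    simp only [negTerms, V20.pval, List.map_cons, List.sum_cons, V20.tval] at ih ⊢
    rw [ih]; push_cast; ring

/-- Atoms are unchanged by negation. [folklore] -/
theorem mem_negTerms {P : List V20.Term} {T : V20.Term} (h : T ∈ negTerms P) : ∃ U ∈ P, U.2 = T.2 ∧ U.1 = -T.1 := by
  unfold negTerms at h
  rw [List.mem_map] at h
  obtain ⟨U, hU, rfl⟩ := h
  exact ⟨U, hU, rfl, by simp⟩

/-- **Domination of a non-negative term list refutes the model** (the inequality branch of `CU.domOK_sound`, for an arbitrary term list). [folklore] -/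
theorem domPolyOK_sound (hordA : ordAtomsOK ord = true) (M : Model (dlist d) ord s x v)
    {ctx : List LinD} (hctx : ∀ G ∈ ctx, 0 ≤ G.ev d) {ctxL : List LRow} (hctxL : ∀ r ∈ ctxL, r.Holds (ell x) ∧ r.WF)
    {poly : List V20.Term} (hP0 : 0 ≤ V20.pval v poly) {n0 ud : ℕ} {comps : List Comp}
    (h : domPolyOK ctx ctxL ord s poly n0 ud comps = true) : False := by
  classical
  have MV := M.toV20
  unfold domPolyOK at h
  simp only [Bool.and_eq_true, decide_eq_true_eq, List.all_eq_true] at h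
  obtain ⟨⟨⟨⟨⟨⟨⟨⟨⟨hn0, hneg⟩, hud⟩, hnz⟩, hatoms⟩, hcov⟩, hmem⟩, hnd⟩, hsum⟩, hall⟩ := h
  set w : ℕ → ℝ := fun n => V20.tval v (poly.getD n (0, [])) with hw
  have hT0a := hatoms _ (V20.term_getD_mem poly hn0)
  have hg0 : (poly.getD n0 (0, [])).1 ≠ 0 := hnz _ (V20.term_getD_mem poly hn0)
  have hklt : ∀ c ∈ comps, c.k < poly.length := by
    intro c hc
    have := hmem c hc
    unfold V20.posTerms at this
    exact List.mem_range.1 (List.mem_filter.1 this).1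
  have hbounds : (comps.map fun c => |w c.k| * ud).sum ≤ (comps.map fun c => (c.un : ℝ) * |w n0|).sum :=
    List.sum_le_sum fun c hc => compOK_sound d hordA M hctx hctxL hatoms hnz hn0 hud (hklt c hc) (hall c hc)
  have hsumR : ((comps.map Comp.un).sum : ℝ) < ud := by exact_mod_cast hsum
  have hudR : (0 : ℝ) < ud := by exact_mod_cast hud
  have hw0 : 0 < |w n0| := by
    simp only [hw]
    rw [V20.abs_tval_eq MV.xpos MV.hv _ hT0a]
    exact mul_pos (abs_pos.2 (by exact_mod_cast hg0)) (V20.lprod_pos MV.xpos _)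
  have hlt : (comps.map fun c => |w c.k|).sum < |w n0| := by
    have e1 : (comps.map fun c => |w c.k| * ud).sum = (comps.map fun c => |w c.k|).sum * ud := by
      rw [List.sum_map_mul_right]
    have e2 : (comps.map fun c => (c.un : ℝ) * |w n0|).sum = ((comps.map Comp.un).sum : ℝ) * |w n0| := by
      push_cast; rw [List.map_map, ← List.sum_map_mul_right]; rfl
    rw [e1, e2] at hbounds
    nlinarith
  set posS := (V20.posTerms ord s poly).toFinset with hposS
  have hposSub : posS ⊆ Finset.range poly.length := by
    intro n hn
    rw [hposS, List.mem_toFinset] at hn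
    unfold V20.posTerms at hn
    exact Finset.mem_range.2 (List.mem_range.1 (List.mem_filter.1 hn).1)
  have hrest : ∀ n ∈ Finset.range poly.length \ posS, w n ≤ 0 := by
    intro n hn
    rw [Finset.mem_sdiff, Finset.mem_range, hposS, List.mem_toFinset] at hn
    have htn : V20.termNeg ord s (poly.getD n (0, [])) = true := by
      have := (V20.mem_posTerms_iff (ord := ord) (s := s) hn.1).not.1 hn.2
      simpa using this
    exact V20.tval_nonpos_of_termNeg MV.xpos MV.hv _ (hatoms _ (V20.term_getD_mem poly hn.1)) htn
  have hn0rest : n0 ∈ Finset.range poly.length \ posS := by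
    rw [Finset.mem_sdiff, Finset.mem_range, hposS, List.mem_toFinset]
    refine ⟨hn0, fun hm => ?_⟩
    have := (V20.mem_posTerms_iff (ord := ord) (s := s) hn0).1 hm
    rw [this] at hneg
    exact Bool.false_ne_true hneg
  have hpv : V20.pval v poly = ∑ n ∈ Finset.range poly.length, w n := V20.pval_eq_sum_range v poly
  have hsplit : V20.pval v poly = ∑ n ∈ posS, w n + ∑ n ∈ Finset.range poly.length \ posS, w n := by
    rw [hpv, ← Finset.sum_sdiff hposSub, add_comm]
  have hrestle : ∑ n ∈ Finset.range poly.length \ posS, w n ≤ w n0 := by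
    rw [← Finset.add_sum_erase _ _ hn0rest]
    have : ∑ n ∈ (Finset.range poly.length \ posS).erase n0, w n ≤ 0 :=
      Finset.sum_nonpos fun n hn => hrest n (Finset.mem_of_mem_erase hn)
    linarith
  have hposle : ∑ n ∈ posS, w n ≤ (comps.map fun c => |w c.k|).sum := by
    have hsub2 : posS ⊆ (comps.map Comp.k).toFinset := by
      intro n hn
      rw [hposS, List.mem_toFinset] at hn
      obtain ⟨c, hc, hck⟩ := hcov n hn
      rw [List.mem_toFinset, List.mem_map]; exact ⟨c, hc, hck⟩
    calc ∑ n ∈ posS, w n ≤ ∑ n ∈ posS, |w n| := Finset.sum_le_sum fun n _ => le_abs_self _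
      _ ≤ ∑ n ∈ (comps.map Comp.k).toFinset, |w n| :=
          Finset.sum_le_sum_of_subset_of_nonneg hsub2 fun n _ _ => abs_nonneg _
      _ = ((comps.map Comp.k).map fun n => |w n|).sum := List.sum_toFinset _ hnd
      _ = (comps.map fun c => |w c.k|).sum := by rw [List.map_map]; rfl
  have hw0le : w n0 ≤ 0 := hrest n0 hn0rest
  have : |w n0| = -w n0 := abs_of_nonpos hw0le
  linarith

/-- **Soundness of the second-layer checker (abstract form).** [folklore] -/
theorem certOK2_sound (hordA : ordAtomsOK ord = true) (M : Model (dlist d) ord s x v) :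
    ∀ (c : Cert2) (ctx : List LinD) (ctxL : List LRow), (∀ G ∈ ctx, 0 ≤ G.ev d) → (∀ r ∈ ctxL, r.Holds (ell x) ∧ r.WF) →
      certOK2 ord s ctx ctxL c = true → False
  | .leaf c, ctx, ctxL, hctx, hctxL, h => certOK_sound d hordA M c ctx ctxL hctx hctxL h
  | .splitD hF cp cn, ctx, ctxL, hctx, hctxL, h => by
    unfold certOK2 at h
    simp only [Bool.and_eq_true] at h
    obtain ⟨hp, hn⟩ := h
    rcases le_total 0 (hF.ev d) with hle | hle
    · exact certOK2_sound hordA M cp (ctx ++ [hF]) ctxL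
        (fun G hG => by
          rcases List.mem_append.1 hG with hG | hG
          · exact hctx G hG
          · simp at hG; rw [hG]; exact hle) hctxL hp
    · exact certOK2_sound hordA M cn (ctx ++ [ldSmul (-1) hF]) ctxL
        (fun G hG => by
          rcases List.mem_append.1 hG with hG | hG
          · exact hctx G hG
          · simp at hG; rw [hG, ev_ldSmul]; linarith) hctxL hn
  | .argmax3 f0 f1 f2 c0 c1 c2, ctx, ctxL, hctx, hctxL, h => by
    unfold certOK2 at h
    simp only [Bool.and_eq_true] at h
    obtain ⟨⟨h0, h1⟩, h2⟩ := h
    obtain ⟨f, hf, hmax⟩ := exists_max_of_list d [f0, f1, f2] (by simp)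
    simp only [List.mem_cons, List.mem_nil_iff, or_false] at hf
    have hm : ∀ g ∈ [f0, f1, f2], g.ev d ≤ f.ev d := hmax
    rcases hf with rfl | rfl | rfl
    · exact certOK2_sound hordA M c0 _ ctxL (maxCtx_nonneg d hctx fun g hg => hm g (by simp at hg ⊢; tauto)) hctxL h0
    · exact certOK2_sound hordA M c1 _ ctxL (maxCtx_nonneg d hctx fun g hg => hm g (by simp at hg ⊢; tauto)) hctxL h1
    · exact certOK2_sound hordA M c2 _ ctxL (maxCtx_nonneg d hctx fun g hg => hm g (by simp at hg ⊢; tauto)) hctxL h2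
  | .argmax4 f0 f1 f2 f3 c0 c1 c2 c3, ctx, ctxL, hctx, hctxL, h => by
    unfold certOK2 at h
    simp only [Bool.and_eq_true] at h
    obtain ⟨⟨⟨h0, h1⟩, h2⟩, h3⟩ := h
    obtain ⟨f, hf, hmax⟩ := exists_max_of_list d [f0, f1, f2, f3] (by simp)
    simp only [List.mem_cons, List.mem_nil_iff, or_false] at hf
    have hm : ∀ g ∈ [f0, f1, f2, f3], g.ev d ≤ f.ev d := hmax
    rcases hf with rfl | rfl | rfl | rfl
    · exact certOK2_sound hordA M c0 _ ctxL (maxCtx_nonneg d hctx fun g hg => hm g (by simp at hg ⊢; tauto)) hctxL h0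
    · exact certOK2_sound hordA M c1 _ ctxL (maxCtx_nonneg d hctx fun g hg => hm g (by simp at hg ⊢; tauto)) hctxL h1
    · exact certOK2_sound hordA M c2 _ ctxL (maxCtx_nonneg d hctx fun g hg => hm g (by simp at hg ⊢; tauto)) hctxL h2
    · exact certOK2_sound hordA M c3 _ ctxL (maxCtx_nonneg d hctx fun g hg => hm g (by simp at hg ⊢; tauto)) hctxL h3
  | .argmax5 f0 f1 f2 f3 f4 c0 c1 c2 c3 c4, ctx, ctxL, hctx, hctxL, h => by
    unfold certOK2 at h
    simp only [Bool.and_eq_true] at h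
    obtain ⟨⟨⟨⟨h0, h1⟩, h2⟩, h3⟩, h4⟩ := h
    obtain ⟨f, hf, hmax⟩ := exists_max_of_list d [f0, f1, f2, f3, f4] (by simp)
    simp only [List.mem_cons, List.mem_nil_iff, or_false] at hf
    have hm : ∀ g ∈ [f0, f1, f2, f3, f4], g.ev d ≤ f.ev d := hmax
    rcases hf with rfl | rfl | rfl | rfl | rfl
    · exact certOK2_sound hordA M c0 _ ctxL (maxCtx_nonneg d hctx fun g hg => hm g (by simp at hg ⊢; tauto)) hctxL h0
    · exact certOK2_sound hordA M c1 _ ctxL (maxCtx_nonneg d hctx fun g hg => hm g (by simp at hg ⊢; tauto)) hctxL h1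
    · exact certOK2_sound hordA M c2 _ ctxL (maxCtx_nonneg d hctx fun g hg => hm g (by simp at hg ⊢; tauto)) hctxL h2
    · exact certOK2_sound hordA M c3 _ ctxL (maxCtx_nonneg d hctx fun g hg => hm g (by simp at hg ⊢; tauto)) hctxL h3
    · exact certOK2_sound hordA M c4 _ ctxL (maxCtx_nonneg d hctx fun g hg => hm g (by simp at hg ⊢; tauto)) hctxL h4
  | .domM4 r c neg n0 ud comps, ctx, ctxL, hctx, hctxL, h => by
    unfold certOK2 at h
    simp only [Bool.and_eq_true] at h
    obtain ⟨hval, hdom⟩ := h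
    have hval' := hval
    simp only [PSpec.valid, Bool.and_eq_true, decide_eq_true_eq] at hval'
    obtain ⟨⟨⟨hr, hc⟩, hr6⟩, hc6⟩ := hval'
    have h0 : V20.pval v (m4Poly r c) = 0 := M.m4 r c hr hc hr6 hc6
    have hP0 : 0 ≤ V20.pval v (signedM4 r c neg) := by
      unfold signedM4; split_ifs
      · rw [pval_negTerms, h0]; simp
      · rw [h0]
    exact domPolyOK_sound d hordA M hctx hctxL hP0 hdom

/-! ## Main theorems of the pieces layer -/

/-- **SOUNDNESS OF THE SECOND-LAYER CHECKER**: if both orientations of the chamber order `ofSigma σ` carry accepted second-layer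
certificates, every support of the chamber of `σ` satisfies `ζ(2,6; d) ≤ 19`. [folklore] -/
theorem posRootLawOn_of_checkChamber2 (σ : Fin 21 → Fin 6 × Fin 6) (cpos cneg : Cert2)
    (h : checkChamber2 (ofSigma σ) cpos cneg = true) (d : Fin 6 → ℕ)
    (hd : StrictMono ((fun p : Fin 6 × Fin 6 => d p.1 + d p.2) ∘ σ)) : PosRootLawOn 2 6 19 d := by
  unfold checkChamber2 at h
  simp only [Bool.and_eq_true] at h
  obtain ⟨⟨hA, hp⟩, hn⟩ := h
  have hord := ordOK_of_chamber σ hA d hd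
  intro S hS
  by_contra hlt
  have h20 : 20 ≤ ((pdet (dlist d) S).roots.toFinset.filter (fun t => 0 < t)).card := by
    unfold pdet; rw [dfun_dlist]; push Not at hlt; exact hlt
  obtain ⟨x, M⟩ := model_of_twenty hord hS h20
  have hctx : ∀ G ∈ baseCtx (ofSigma σ), 0 ≤ G.ev d := by
    intro G hG
    unfold baseCtx at hG
    rw [List.mem_map] at hG
    obtain ⟨i, hi, rfl⟩ := hG
    rw [List.mem_range] at hi
    have := one_le_pairForm d hA M.toV20 rfl (p := (i, i + 1)) ⟨Nat.lt_succ_self i, by omega⟩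
    omega
  by_cases hs : 0 < (pdet (dlist d) S).coeff (Epos (dlist d) (ofSigma σ) 0)
  · rw [show decide (0 < (pdet (dlist d) S).coeff (Epos (dlist d) (ofSigma σ) 0)) = true by simp [hs]] at M
    exact certOK2_sound d hA M cpos _ [] hctx (by simp) hp
  · rw [show decide (0 < (pdet (dlist d) S).coeff (Epos (dlist d) (ofSigma σ) 0)) = false by simp [hs]] at M
    exact certOK2_sound d hA M cneg _ [] hctx (by simp) hn

/-- A table of second-layer chamber certificates. [folklore] -/
abbrev Table2 := List (ℕ × Cert2 × Cert2)

/-- Check a second-layer table against the chamber table of record. [folklore] -/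
noncomputable def checkTable2 (T : Table2) : Bool := T.all fun e => checkChamber2 (ofSigma (chamber e.1)) e.2.1 e.2.2

/-- **Every chamber of an accepted second-layer table carries the door-A row.** [folklore] -/
theorem doorA26_on_chambers_of_checkTable2 (T : Table2) (h : checkTable2 T = true) :
    ∀ n ∈ T.map Prod.fst, ∀ d : Fin 6 → ℕ,
      StrictMono ((fun p : Fin 6 × Fin 6 => d p.1 + d p.2) ∘ chamber n) → PosRootLawOn 2 6 19 d := by
  intro n hn d hd
  rw [List.mem_map] at hn
  obtain ⟨e, he, rfl⟩ := hn
  unfold checkTable2 at h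
  rw [List.all_eq_true] at h
  exact posRootLawOn_of_checkChamber2 (chamber e.1) e.2.1 e.2.2 (h e he) d hd

end Summit.ValiantsHypothesis.ValiantsHypothesis.Theorems.LacunarySymmetroidMatrixDescartes.Census.CU
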